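import Literature.MathematicalPhysics.QuantumFieldTheory.Balaban1983to89.B9Thm313WholeLeftZ

/-!
# `Balaban1983to89.B9Thm313WholeSupReadersCut` — [B9] Theorem 3.13 (p. 426): the sup entries (3.42)₁ (𝔊) and (3.42)₂ (∇_U𝔊) of the
# Theorem-3.13 reduction RE-ISSUED over the five KEPT fields `gD2 gQs2 rgd2 c1_2 q2` of `Letters313Z` as separate hypotheses — the reader
# layer under the N06 LETTERS-SPECIES re-cut (WANTED №g26-7), so that a cut schema without `rgd1 ∕ gD1` can feed them

T. Bałaban, *Propagators for lattice gauge theories in a background field*, Commun. Math. Phys. **99** (1985) 389–434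
[`Balaban1985BackgroundPropagators`, "B9"]; [4] = T. Bałaban, *Propagators and renormalization transformations for lattice gauge
theories. II*, Commun. Math. Phys. **96** (1984) 223–250 [`Balaban1984PropagatorsII`].

statement-level skeleton of published theorems with citation tags; proofs where landed; nothing here is a claim about the Yang–Mills
mass gap

THE PRINTED LOCUS (held text `paper:balaban1985-cmp99-background-propagators`).  p. 426, (3.153): *"𝔊 = G₁ − G₁DRD\*G₁ − G₁Q\*(QG₁Q\*)⁻¹QG₁
= G₁𝔓\* = 𝔓G₁"*; *"The formulas (3.147), (3.153) permit us to reduce properties of the operators 𝔓, 𝔊 to the corresponding properties of the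
operators G′, (Q′G′²Q′\*)⁻¹, G₁, (QG₁Q\*)⁻¹"*; Theorem 3.13 p. 426 (Theorem 3.3 holds for 𝔊: the sup entries (3.42) p. 397 and the Hölder entries
(3.43) p. 398).

THE POINT (cell `pub/ym-inputs` seat p04 g2, LOCATE «READER LAYER» 2026-08-28T11:03Z on `pub/pub-ymgap/INBOX.md`; hazard «N06-LETTERS-SPECIES»
of ★★OWNER ym3-torus-plan RULING g26-№21 (5), WANTED №g26-7; the cut SCHEMA and the composites L4–L7 are dag-n06-l g19's).  The located field
`Letters313Z.rgd1` (and `gD1`, read only next to it) is read by `GG_entry2_of_lettersZ` and `GG_probe43R_of_lettersZ`, already re-cut without it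
(`B9Thm313WholeEntry2HolderCut`, `B9Thm313WholeProbe43RHolderCut`).  The OTHER sup-side readers of `Letters313Z` under the Theorem-3.13 leaf read
ONLY the kept fields `gD2 gQs2 rgd2 c1_2 q2` but take the WHOLE structure as a binder, so no cut schema can be passed to them.  THIS FILE re-issues
`B9Thm313WholeZ.GG_entry0_of_lettersZ` ((3.42)₁ of 𝔊) and `B9Thm313WholeLeftZ.GG_entry1_of_lettersZ` ((3.42)₂, ∇_U𝔊) with the structure binder
replaced by EXACTLY those five fields as hypotheses `hLgD2 hLgQs2 hLrgd2 hLc1_2 hLq2` (the fields' types VERBATIM; the weight binders `(wZ) (hwZ)`, implicit in the parent where the record fixed them, become EXPLICIT right before the field hypotheses — `hwZ` occurs in the field types only inside proofs, so it is not unifiable); every other binder, the conclusions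
and the constants are byte-identical and the proofs are the parents' with `hL.x ↦ hx`:
* §1 ★ `GG_entry0_cut_of_letters` — statement of `GG_entry0_of_lettersZ` over the five fields;
* §2 ★ `GG_entry1_cut_of_letters` — statement of `GG_entry1_of_lettersZ` over the five fields (+ `Letters313DZ`, unchanged).
The parents follow from these by projection (`hL.gD2 …`); a cut schema (dag-n06-l) feeds them by its projections.  The (3.43)₁ probe reader is
re-issued alike in `B9Thm313WholeProbe43LCut`.

HONEST SCOPE.  Kernel bookkeeping over landed modules (`hasMaj_frakG_classes`, `hasMaj_right_of_step(_weight)`, `hasMaj_left_right(R)`,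
`GG_comp_eq ∕ D_GG_eq ∕ E_GG_eq`); the five kept letters stay HYPOTHESES of printed species, nothing of [B9]'s estimates is asserted; COUNT-NEUTRAL;
N06 NOT discharged; no summit or sub-problem statement is proved (YM₃ on T³ = ladder rung R3, a RECORD rung — not T⁴, not a mass gap, not Clay).
One finite lattice at a time.  Seat `ym-inputs-p04` g2 (prover-ym-inputs-p04-g2-0), 2026-08-28; NEW file, nothing landed is modified.
-/

namespace Literature.MathematicalPhysics.QuantumFieldTheory.Balaban1983to89.B9Thm313WholeSupReadersCut

open Literature.MathematicalPhysics.QuantumFieldTheory.Balaban1983to89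
open Finset Filter B6RandomWalk B6RandomWalkHom B9Thm34Ext B9Thm37GlueCor36 B11SectG B9SectDSup
open B9Thm37AllNorms B9Thm37AllNormsInstances B9FromB6 B9FromB6ModelSignsOn B9SectBStepWhole B9Thm312Whole B9Thm312WholeLeaf
open B9Thm312WholeLeft B9Thm313Whole B9Thm313WholeLeft B9Thm313WholeZ B9Thm313WholeLeftZ

noncomputable section

section OneMember

variable {g : B9.Geometry} {B : B9.Backgrounds} {X Y Z W : Type}
variable [Fintype X] [Fintype Y] [Fintype Z] [Fintype W] [Fintype g.Site]

/-! ## §1 The sup entry (3.42)₁ of 𝔊 over the five kept coarse letters -/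

omit [Fintype Y] in
/-- ★ **THEOREM 3.13, ENTRY (3.42)₁ FOR 𝔊 OVER THE FIVE KEPT LETTERS** (statement of `B9Thm313WholeZ.GG_entry0_of_lettersZ` with the binder
`hL : Letters313Z …` replaced by its fields `gD2` (G₀D : W¹ → 𝔠⁽²⁾), `gQs2` (G₀Q\* : Z_{wZ} → 𝔠⁽²⁾), `rgd2` (RD\*G₁ : 𝔠⁽⁰⁾ → W¹), `c1_2`
((QG₁Q\*)⁻¹ : Z² → Z_{wZ}), `q2` (Q : 𝔠⁽²⁾ → Z²) as hypotheses; proof verbatim) — the reduction at U: from Theorem 3.3 (3.42)₁ for G₀ (`he0`), the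
step K′₁ = G₀(Δ′_π + Δ⁽²⁾_π) on 𝔠⁽²⁾ (`hK`, θc < 1), the resolvent identity of (3.138) (`Identities`) and (3.153): |(𝔊λ)(x)| ≦ C(Lʲη)²e^{−ρ′d(y,y′)}|λ|
for x ∈ Δ(y), supp λ ⊂ Δ(y′), C = `const313 (B₀(1−θc)⁻¹) (B₃(1−θc)⁻¹) B₃ c`, every ρ′ ≧ 0 with ρ′ + 3σ ≦ ρ (ρ ≦ δ₀, ρ ≦ δ₃, ρ + σ ≦ δ_K).
[cite: Balaban1985BackgroundPropagators, Thm 3.13 p.426 + (3.153) p.426 + (3.138) p.423 + (3.42) p.397; Balaban1984PropagatorsII, (2.52)–(2.56) pp.232–233 + Lemma 2.1 (2.61) p.234] -/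
theorem GG_entry0_cut_of_letters {R₀ : ℝ} {H₀ : Prop} (hG : GeoOK g) {𝔬 : Ops g B X Y Z W} {U : B.Cfg}
    {θ B₀ B₃ δ₀ δ₃ δK ρ ρ' σ c : ℝ} (hrow : RowSum (toB6 g R₀ H₀) σ c) (hc : 0 ≤ c)
    (hθ : 0 ≤ θ) (hB₀ : 0 ≤ B₀) (hB₃ : 0 ≤ B₃) (hσ : 0 ≤ σ) (hρ' : 0 ≤ ρ') (hρ'ρ : ρ' + 3 * σ ≤ ρ) (hρS : ρ ≤ δ₀)
    (hρ₃ : ρ ≤ δ₃) (hρδ : ρ + σ ≤ δK) (hq : θ * c < 1)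
    (hK : HasMaj (cNorm R₀ H₀ 𝔬.blk hG.lenle 2) (cNorm R₀ H₀ 𝔬.blk hG.lenle 2) (𝔬.G0 U ∘ₗ (𝔬.Tpi U + 𝔬.T2 U))
      (fun a b => θ * Real.exp (-(δK * g.dist a b))))
    (he0 : HasMajorant (g := toB6 g R₀ H₀) 𝔬.blk (𝔬.G0 U) (fun a b => B₀ * g.len a ^ 2 * Real.exp (-(δ₀ * g.dist a b))))
    (wZ : g.Site → ℝ) (hwZ : ∀ y, 0 < wZ y)
    (hLgD2 : HasMaj (cNorm R₀ H₀ 𝔬.blkW hG.lenle 1) (cNorm R₀ H₀ 𝔬.blk hG.lenle 2) (𝔬.G0 U ∘ₗ 𝔬.Dv U)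
      (fun a b => B₃ * Real.exp (-(δ₃ * g.dist a b))))
    (hLgQs2 : HasMaj (weightNorm (BlockNorm.ofBlocks (toB6 g R₀ H₀) 𝔬.blkZ) wZ fun y => (hwZ y).le) (cNorm R₀ H₀ 𝔬.blk hG.lenle 2)
      (𝔬.G0 U ∘ₗ 𝔬.Qstar U) (fun a b => B₃ * Real.exp (-(δ₃ * g.dist a b))))
    (hLrgd2 : HasMaj (cNorm R₀ H₀ 𝔬.blk hG.lenle 0) (cNorm R₀ H₀ 𝔬.blkW hG.lenle 1) (𝔬.R U ∘ₗ 𝔬.Dvstar U ∘ₗ 𝔬.G1 U ∘ₗ LinearMap.id)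
      (fun a b => B₃ * Real.exp (-(δ₃ * g.dist a b))))
    (hLc1_2 : HasMaj (cNorm R₀ H₀ 𝔬.blkZ hG.lenle 2) (weightNorm (BlockNorm.ofBlocks (toB6 g R₀ H₀) 𝔬.blkZ) wZ fun y => (hwZ y).le) (𝔬.C1 U)
      (fun a b => B₃ * Real.exp (-(δ₃ * g.dist a b))))
    (hLq2 : HasMaj (cNorm R₀ H₀ 𝔬.blk hG.lenle 2) (cNorm R₀ H₀ 𝔬.blkZ hG.lenle 2) (𝔬.Q U) (fun a b => B₃ * Real.exp (-(δ₃ * g.dist a b))))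
    (hI : Identities 𝔬 U) :
    HasMajorant (g := toB6 g R₀ H₀) 𝔬.blk (𝔬.GG U)
      (fun a b => const313 (B₀ * (1 - θ * c)⁻¹) (B₃ * (1 - θ * c)⁻¹) B₃ c * g.len a ^ 2 *
        Real.exp (-(ρ' * g.dist a b))) := by
  have hinv1 : 0 ≤ (1 - θ * c)⁻¹ := inv_nonneg.mpr (by linarith)
  have hA₁ : 0 ≤ B₀ * (1 - θ * c)⁻¹ := mul_nonneg hB₀ hinv1
  have hA₃ : 0 ≤ B₃ * (1 - θ * c)⁻¹ := mul_nonneg hB₃ hinv1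
  have hfix1 := fix_of_inverses hI.invG0' hI.invG1
  have hρ0 : 0 ≤ ρ := by linarith
  have htri : Triangle254 (toB6 g R₀ H₀) := fun a b c => hG.tri a b c
  -- (a) G₁ : 𝔠⁽⁰⁾ → 𝔠⁽²⁾
  have h0 : HasMaj (BlockNorm.ofBlocks (toB6 g R₀ H₀) 𝔬.blk) (BlockNorm.ofBlocks (toB6 g R₀ H₀) 𝔬.blk) (𝔬.G0 U)
      (fun a b => B₀ * g.len a ^ 2 * Real.exp (-(δ₀ * g.dist a b))) :=
    hasMaj_of_hasMajorant (g := toB6 g R₀ H₀) 𝔬.blk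
      (fun a b => mul_nonneg (mul_nonneg hB₀ (sq_nonneg _)) (Real.exp_nonneg _)) he0
  have hS : HasMaj (cNorm R₀ H₀ 𝔬.blk hG.lenle 0) (cNorm R₀ H₀ 𝔬.blk hG.lenle 2) (𝔬.G0 U ∘ₗ LinearMap.id)
      (fun a b => B₀ * Real.exp (-(δ₀ * g.dist a b))) := by
    rw [LinearMap.comp_id]
    refine (hasMaj_cNorm_of_hasMaj hG 2 0 h0).mono fun y y' => le_of_eq ?_
    have hy : g.len y ^ 2 ≠ 0 := pow_ne_zero 2 (hG.lenpos y).ne'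
    simp only [wt, pow_zero, mul_one]
    rw [mul_assoc B₀, mul_comm (g.len y ^ 2), ← mul_assoc B₀, mul_assoc, mul_assoc, mul_inv_cancel₀ hy, mul_one]
  have hG1 := hasMaj_right_of_step hG hrow hθ hB₀ hρ0 hρS hρδ hK hS hfix1 hq
  -- (b) G₁D : W¹ → 𝔠⁽²⁾, (c) G₁Q* : Z⁰ → 𝔠⁽²⁾
  have hGD := hasMaj_right_of_step hG hrow hθ hB₃ hρ0 hρ₃ hρδ hK hLgD2 hfix1 hq
  have hGQ := hasMaj_right_of_step_weight hG hwZ hrow hθ hB₃ hρ0 hρ₃ hρδ hK hLgQs2 hfix1 hq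
  -- (d) QG₁ : 𝔠⁽⁰⁾ → Z², rate ρ′ + 2σ
  have hQG : HasMaj (cNorm R₀ H₀ 𝔬.blk hG.lenle 0) (cNorm R₀ H₀ 𝔬.blkZ hG.lenle 2) (𝔬.Q U ∘ₗ (𝔬.G1 U ∘ₗ LinearMap.id))
      (fun a b => (cNorm R₀ H₀ 𝔬.blk hG.lenle 2 (X := X)).κ * B₃ * (B₀ * (1 - θ * c)⁻¹) * c *
        Real.exp (-((ρ' + 2 * σ) * g.dist a b))) :=
    hasMaj_comp_exp htri hG.dnn hrow hB₃ hA₁ (by linarith) (by linarith) (by linarith) hLq2 hG1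
  simp only [cNorm_κ, one_mul] at hQG
  -- all six letters at the rate δ := ρ′ + 2σ
  have hδ₁ : ρ' + 2 * σ ≤ ρ := by linarith
  have hδ₃ : ρ' + 2 * σ ≤ δ₃ := by linarith
  have h := hasMaj_frakG_classes (bA := cNorm R₀ H₀ 𝔬.blk hG.lenle 0) (bC := cNorm R₀ H₀ 𝔬.blk hG.lenle 2)
    (bP := cNorm R₀ H₀ 𝔬.blkW hG.lenle 1) (bQ₁ := cNorm R₀ H₀ 𝔬.blkZ hG.lenle 2)
    (bQ₂ := weightNorm (BlockNorm.ofBlocks (toB6 g R₀ H₀) 𝔬.blkZ) wZ fun y => (hwZ y).le)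
    htri hG.dnn hrow hA₁ hA₃ hB₃ hA₃ hB₃ (mul_nonneg (mul_nonneg hB₃ hA₁) hc) hρ' hσ le_rfl
    (hG1.of_rate_le hG.dnn hA₁ hδ₁) (hGD.of_rate_le hG.dnn hA₃ hδ₁) (hLrgd2.of_rate_le hG.dnn hB₃ hδ₃)
    (hGQ.of_rate_le hG.dnn hA₃ hδ₁) (hLc1_2.of_rate_le hG.dnn hB₃ hδ₃) (hQG.of_rate_le hG.dnn
      (mul_nonneg (mul_nonneg hB₃ hA₁) hc) le_rfl)
  rw [← GG_comp_eq hI LinearMap.id, LinearMap.comp_id] at h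
  simp only [cNorm_κ, weightNorm_ofBlocks_κ, one_mul] at h
  have hC0 : 0 ≤ const313 (B₀ * (1 - θ * c)⁻¹) (B₃ * (1 - θ * c)⁻¹) B₃ c := const313_nonneg hA₁ hA₃ hB₃ hc
  have h2 : HasMaj (cNorm R₀ H₀ 𝔬.blk hG.lenle 0) (cNorm R₀ H₀ 𝔬.blk hG.lenle 2) (𝔬.GG U)
      (fun a b => const313 (B₀ * (1 - θ * c)⁻¹) (B₃ * (1 - θ * c)⁻¹) B₃ c * Real.exp (-(ρ' * g.dist a b))) :=
    h.mono fun a b => le_of_eq rfl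
  have h' := hasMajorantHom_of_hasMaj_cNorm hG (fun a b => mul_nonneg hC0 (Real.exp_nonneg _)) h2
  rw [hasMajorantHom_iff] at h'
  refine hasMajorant_mono (g := toB6 g R₀ H₀) 𝔬.blk h' fun a b => le_of_eq ?_
  simp only [wt, pow_zero, inv_one, mul_one]
  ring

/-! ## §2 The left sup entry (3.42)₂ of 𝔊 (∇_U𝔊) over the five kept coarse letters -/

/-- ★ **THEOREM 3.13, ENTRY (3.42)₂ FOR 𝔊 OVER THE FIVE KEPT LETTERS** (statement of `B9Thm313WholeLeftZ.GG_entry1_of_lettersZ` with the binder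
`hL : Letters313Z …` replaced by its fields `gD2 gQs2 rgd2 c1_2 q2` as hypotheses; `hLD : Letters313DZ …` (`dgQs`, `rgdH`, `dgDH` through the
Hölder class `bH`) unchanged; proof verbatim) — the reduction at U for ∇_U𝔊: from Theorem 3.3's (3.42)₁ (`he0`) and (3.42)₂ (`hLS.e1`) for G₀, the
step on 𝔠⁽²⁾ (`hK`) and its derivative (`hLS.stepD1`), the resolvent identity of (3.138) and (3.153): |(∇_U𝔊λ)(x)| ≦ C·Lʲη·e^{−ρ′d(y,y′)}|λ| for
x ∈ Δ(y), supp λ ⊂ Δ(y′), C = `constD313 (B₀ + θ′·B₀(1−θc)⁻¹·c) θ′ (B₀(1−θc)⁻¹) (B₃(1−θc)⁻¹) B₃ κ_H c`, every ρ′ ≧ 0 with ρ′ + 3σ ≦ ρ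
(ρ ≦ δ₀, ρ ≦ δ₃, ρ + σ ≦ δ_K). [cite: Balaban1985BackgroundPropagators, Thm 3.13 p.426 + (3.152)–(3.153) p.426 + (3.138) p.423 + (3.42)–(3.44) pp.397–398 + (3.49) p.399; Balaban1984PropagatorsII, (2.54) p.233 + Lemma 2.1 (2.61) p.234] -/
theorem GG_entry1_cut_of_letters {R₀ : ℝ} {H₀ : Prop} (hG : GeoOK g) {𝔬 : Ops g B X Y Z W} {U : B.Cfg}
    {bH : BlockNorm (toB6 g R₀ H₀) (W → ℝ)}
    {θ θ' B₀ B₃ δ₀ δ₃ δK ρ ρ' σ c : ℝ} (hrow : RowSum (toB6 g R₀ H₀) σ c) (hc : 0 ≤ c)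
    (hθ : 0 ≤ θ) (hθ' : 0 ≤ θ') (hB₀ : 0 ≤ B₀) (hB₃ : 0 ≤ B₃) (hσ : 0 ≤ σ) (hρ' : 0 ≤ ρ') (hρ'ρ : ρ' + 3 * σ ≤ ρ) (hρS : ρ ≤ δ₀)
    (hρ₃ : ρ ≤ δ₃) (hρδ : ρ + σ ≤ δK) (hq : θ * c < 1)
    (hK : HasMaj (cNorm R₀ H₀ 𝔬.blk hG.lenle 2) (cNorm R₀ H₀ 𝔬.blk hG.lenle 2) (𝔬.G0 U ∘ₗ (𝔬.Tpi U + 𝔬.T2 U))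
      (fun a b => θ * Real.exp (-(δK * g.dist a b))))
    (he0 : HasMajorant (g := toB6 g R₀ H₀) 𝔬.blk (𝔬.G0 U) (fun a b => B₀ * g.len a ^ 2 * Real.exp (-(δ₀ * g.dist a b))))
    (hLS : LeftStep 𝔬 R₀ H₀ hG.lenle B₀ δ₀ θ' δK U)
    (wZ : g.Site → ℝ) (hwZ : ∀ y, 0 < wZ y)
    (hLgD2 : HasMaj (cNorm R₀ H₀ 𝔬.blkW hG.lenle 1) (cNorm R₀ H₀ 𝔬.blk hG.lenle 2) (𝔬.G0 U ∘ₗ 𝔬.Dv U)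
      (fun a b => B₃ * Real.exp (-(δ₃ * g.dist a b))))
    (hLgQs2 : HasMaj (weightNorm (BlockNorm.ofBlocks (toB6 g R₀ H₀) 𝔬.blkZ) wZ fun y => (hwZ y).le) (cNorm R₀ H₀ 𝔬.blk hG.lenle 2)
      (𝔬.G0 U ∘ₗ 𝔬.Qstar U) (fun a b => B₃ * Real.exp (-(δ₃ * g.dist a b))))
    (hLrgd2 : HasMaj (cNorm R₀ H₀ 𝔬.blk hG.lenle 0) (cNorm R₀ H₀ 𝔬.blkW hG.lenle 1) (𝔬.R U ∘ₗ 𝔬.Dvstar U ∘ₗ 𝔬.G1 U ∘ₗ LinearMap.id)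
      (fun a b => B₃ * Real.exp (-(δ₃ * g.dist a b))))
    (hLc1_2 : HasMaj (cNorm R₀ H₀ 𝔬.blkZ hG.lenle 2) (weightNorm (BlockNorm.ofBlocks (toB6 g R₀ H₀) 𝔬.blkZ) wZ fun y => (hwZ y).le) (𝔬.C1 U)
      (fun a b => B₃ * Real.exp (-(δ₃ * g.dist a b))))
    (hLq2 : HasMaj (cNorm R₀ H₀ 𝔬.blk hG.lenle 2) (cNorm R₀ H₀ 𝔬.blkZ hG.lenle 2) (𝔬.Q U) (fun a b => B₃ * Real.exp (-(δ₃ * g.dist a b))))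
    (hLD : Letters313DZ 𝔬 R₀ H₀ hG wZ hwZ B₃ δ₃ bH U) (hI : Identities 𝔬 U) :
    HasMajorantHom (g := toB6 g R₀ H₀) 𝔬.blk 𝔬.blkY (𝔬.D U ∘ₗ 𝔬.GG U)
      (fun a b => constD313 (B₀ + θ' * (B₀ * (1 - θ * c)⁻¹) * c) θ' (B₀ * (1 - θ * c)⁻¹) (B₃ * (1 - θ * c)⁻¹) B₃ bH.κ c *
        g.len a * Real.exp (-(ρ' * g.dist a b))) := by
  have hinv1 : 0 ≤ (1 - θ * c)⁻¹ := inv_nonneg.mpr (by linarith)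
  have hA₁ : 0 ≤ B₀ * (1 - θ * c)⁻¹ := mul_nonneg hB₀ hinv1
  have hA₃ : 0 ≤ B₃ * (1 - θ * c)⁻¹ := mul_nonneg hB₃ hinv1
  have hCL : 0 ≤ B₀ + θ' * (B₀ * (1 - θ * c)⁻¹) * c := add_nonneg hB₀ (mul_nonneg (mul_nonneg hθ' hA₁) hc)
  have hfix1 := fix_of_inverses hI.invG0' hI.invG1
  have hρ0 : 0 ≤ ρ := by linarith
  have htri : Triangle254 (toB6 g R₀ H₀) := fun a b c => hG.tri a b c
  -- (a) the right entries of G₁: G₁ : 𝔠⁽⁰⁾ → 𝔠⁽²⁾, G₁D : W¹ → 𝔠⁽²⁾, G₁Q* : Z⁰ → 𝔠⁽²⁾ (as in `GG_entry0_of_letters`)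
  have hG1 : HasMaj (cNorm R₀ H₀ 𝔬.blk hG.lenle 0) (cNorm R₀ H₀ 𝔬.blk hG.lenle 2) (𝔬.G1 U ∘ₗ LinearMap.id)
      (fun a b => B₀ * (1 - θ * c)⁻¹ * Real.exp (-(ρ * g.dist a b))) := by
    rw [LinearMap.comp_id]
    exact hasMaj_entry0_cNorm hG hrow hθ hB₀ hρ0 hρS hρδ hK he0 hfix1 hq
  have hGD := hasMaj_right_of_step hG hrow hθ hB₃ hρ0 hρ₃ hρδ hK hLgD2 hfix1 hq
  have hGQ := hasMaj_right_of_step_weight hG hwZ hrow hθ hB₃ hρ0 hρ₃ hρδ hK hLgQs2 hfix1 hq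
  -- (b) the left-and-right entries ∇G₁ : 𝔠⁽⁰⁾ → 𝔠_Y⁽¹⁾, ∇G₁D : W¹ → 𝔠_Y⁽¹⁾, ∇G₁Q* : Z⁰ → 𝔠_Y⁽¹⁾, all at the rate ρ
  have h10 : HasMaj (BlockNorm.ofBlocks (toB6 g R₀ H₀) 𝔬.blk) (BlockNorm.ofBlocks (toB6 g R₀ H₀) 𝔬.blkY) (𝔬.D U ∘ₗ 𝔬.G0 U)
      (fun a b => B₀ * g.len a * Real.exp (-(δ₀ * g.dist a b))) :=
    hasMaj_of_hasMajorantHom (G := toB6 g R₀ H₀) 𝔬.blk 𝔬.blkY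
      (fun a b => mul_nonneg (mul_nonneg hB₀ (hG.lenle a)) (Real.exp_nonneg _)) hLS.e1
  have hE0 : HasMaj (cNorm R₀ H₀ 𝔬.blk hG.lenle 0) (cNorm R₀ H₀ 𝔬.blkY hG.lenle 1) (𝔬.D U ∘ₗ 𝔬.G0 U ∘ₗ LinearMap.id)
      (fun a b => B₀ * Real.exp (-(δ₀ * g.dist a b))) := by
    rw [LinearMap.comp_id]
    refine (hasMaj_cNorm_of_hasMaj hG 1 0 h10).mono fun y y' => le_of_eq ?_
    have hy : g.len y ≠ 0 := (hG.lenpos y).ne'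
    simp only [wt, pow_zero, pow_one, mul_one]
    rw [mul_assoc B₀, mul_comm (g.len y), ← mul_assoc B₀, mul_assoc, mul_inv_cancel₀ hy, mul_one]
  have hD1 : HasMaj (cNorm R₀ H₀ 𝔬.blk hG.lenle 0) (cNorm R₀ H₀ 𝔬.blkY hG.lenle 1) (𝔬.D U ∘ₗ 𝔬.G1 U ∘ₗ LinearMap.id)
      (fun y y' => (B₀ + θ' * (B₀ * (1 - θ * c)⁻¹) * c) * Real.exp (-(ρ * g.dist y y'))) :=
    hasMaj_left_right hG hrow hθ' hB₀ hA₁ hρ0 hρS le_rfl hρδ hLS.stepD1 hE0 hG1 hfix1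
  -- (c) TERM B = (∇G₁D)(RD*G₁) = (∇G₀D)(RD*G₁) + ((∇G₀T₁)(G₁D))(RD*G₁): the first summand through the Hölder class `bH`, the
  --     second through the sup class W¹ (letter `rgd2`)
  have hρ'₃ : ρ' ≤ δ₃ := by linarith
  have hρ'σ₃ : ρ' + σ ≤ δ₃ := by linarith
  have hB1 : HasMaj (cNorm R₀ H₀ 𝔬.blk hG.lenle 0) (cNorm R₀ H₀ 𝔬.blkY hG.lenle 1)
      ((𝔬.D U ∘ₗ 𝔬.G0 U ∘ₗ 𝔬.Dv U) ∘ₗ (𝔬.R U ∘ₗ 𝔬.Dvstar U ∘ₗ 𝔬.G1 U ∘ₗ LinearMap.id))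
      (fun y y' => bH.κ * B₃ * B₃ * c * Real.exp (-(ρ' * g.dist y y'))) :=
    hasMaj_comp_exp htri hG.dnn hrow hB₃ hB₃ hρ' hρ'₃ hρ'σ₃ hLD.dgDH hLD.rgdH
  have hGDT : HasMaj (cNorm R₀ H₀ 𝔬.blkW hG.lenle 1) (cNorm R₀ H₀ 𝔬.blkY hG.lenle 1)
      ((𝔬.D U ∘ₗ 𝔬.G0 U ∘ₗ (𝔬.Tpi U + 𝔬.T2 U)) ∘ₗ (𝔬.G1 U ∘ₗ 𝔬.Dv U))
      (fun y y' => (cNorm R₀ H₀ 𝔬.blk hG.lenle 2 (X := X)).κ * θ' * (B₃ * (1 - θ * c)⁻¹) * c *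
        Real.exp (-((ρ' + σ) * g.dist y y'))) :=
    hasMaj_comp_exp htri hG.dnn hrow hθ' hA₃ (by linarith) (by linarith) (by linarith) hLS.stepD1 hGD
  simp only [cNorm_κ, one_mul] at hGDT
  have hθA₃ : 0 ≤ θ' * (B₃ * (1 - θ * c)⁻¹) * c := mul_nonneg (mul_nonneg hθ' hA₃) hc
  have hB2 : HasMaj (cNorm R₀ H₀ 𝔬.blk hG.lenle 0) (cNorm R₀ H₀ 𝔬.blkY hG.lenle 1)
      (((𝔬.D U ∘ₗ 𝔬.G0 U ∘ₗ (𝔬.Tpi U + 𝔬.T2 U)) ∘ₗ (𝔬.G1 U ∘ₗ 𝔬.Dv U)) ∘ₗ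
        (𝔬.R U ∘ₗ 𝔬.Dvstar U ∘ₗ 𝔬.G1 U ∘ₗ LinearMap.id))
      (fun y y' => (cNorm R₀ H₀ 𝔬.blkW hG.lenle 1 (X := W)).κ * (θ' * (B₃ * (1 - θ * c)⁻¹) * c) * B₃ * c *
        Real.exp (-(ρ' * g.dist y y'))) :=
    hasMaj_comp_exp htri hG.dnn hrow hθA₃ hB₃ hρ' hρ'₃ le_rfl hGDT hLrgd2
  simp only [cNorm_κ, one_mul] at hB2
  have eB : (𝔬.D U ∘ₗ 𝔬.G1 U ∘ₗ 𝔬.Dv U) ∘ₗ (𝔬.R U ∘ₗ 𝔬.Dvstar U ∘ₗ 𝔬.G1 U ∘ₗ LinearMap.id) =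
      (𝔬.D U ∘ₗ 𝔬.G0 U ∘ₗ 𝔬.Dv U) ∘ₗ (𝔬.R U ∘ₗ 𝔬.Dvstar U ∘ₗ 𝔬.G1 U ∘ₗ LinearMap.id) +
        (((𝔬.D U ∘ₗ 𝔬.G0 U ∘ₗ (𝔬.Tpi U + 𝔬.T2 U)) ∘ₗ (𝔬.G1 U ∘ₗ 𝔬.Dv U)) ∘ₗ
          (𝔬.R U ∘ₗ 𝔬.Dvstar U ∘ₗ 𝔬.G1 U ∘ₗ LinearMap.id)) := by
    rw [comp_fix_left_right (𝔬.D U) (𝔬.Dv U) hfix1, LinearMap.add_comp]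
  have hB := hB1.add hB2
  rw [← eB] at hB
  -- (d) TERM C = (∇G₁Q*)((QG₁Q*)⁻¹QG₁) through the sup classes Z², Z⁰
  have hQG : HasMaj (cNorm R₀ H₀ 𝔬.blk hG.lenle 0) (cNorm R₀ H₀ 𝔬.blkZ hG.lenle 2) (𝔬.Q U ∘ₗ (𝔬.G1 U ∘ₗ LinearMap.id))
      (fun a b => (cNorm R₀ H₀ 𝔬.blk hG.lenle 2 (X := X)).κ * B₃ * (B₀ * (1 - θ * c)⁻¹) * c *
        Real.exp (-((ρ' + 2 * σ) * g.dist a b))) :=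
    hasMaj_comp_exp htri hG.dnn hrow hB₃ hA₁ (by linarith) (by linarith) (by linarith) hLq2 hG1
  simp only [cNorm_κ, one_mul] at hQG
  have hK₁ : 0 ≤ B₃ * (B₀ * (1 - θ * c)⁻¹) * c := mul_nonneg (mul_nonneg hB₃ hA₁) hc
  have hCQG : HasMaj (cNorm R₀ H₀ 𝔬.blk hG.lenle 0) (weightNorm (BlockNorm.ofBlocks (toB6 g R₀ H₀) 𝔬.blkZ) wZ fun y => (hwZ y).le)
      (𝔬.C1 U ∘ₗ (𝔬.Q U ∘ₗ (𝔬.G1 U ∘ₗ LinearMap.id)))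
      (fun a b => (cNorm R₀ H₀ 𝔬.blkZ hG.lenle 2 (X := Z)).κ * B₃ * (B₃ * (B₀ * (1 - θ * c)⁻¹) * c) * c *
        Real.exp (-((ρ' + σ) * g.dist a b))) :=
    hasMaj_comp_exp htri hG.dnn hrow hB₃ hK₁ (by linarith) (by linarith) (by linarith) hLc1_2 hQG
  simp only [cNorm_κ, one_mul] at hCQG
  have hD1Q : HasMaj (weightNorm (BlockNorm.ofBlocks (toB6 g R₀ H₀) 𝔬.blkZ) wZ fun y => (hwZ y).le)
      (cNorm R₀ H₀ 𝔬.blkY hG.lenle 1) (𝔬.D U ∘ₗ 𝔬.G1 U ∘ₗ 𝔬.Qstar U)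
      (fun y y' => (B₃ + θ' * (B₃ * (1 - θ * c)⁻¹) * c) * Real.exp (-((ρ' + σ) * g.dist y y'))) :=
    hasMaj_left_right hG hrow hθ' hB₃ hA₃ (by linarith) (by linarith) (by linarith) (by linarith) hLS.stepD1 hLD.dgQs hGQ
      hfix1
  have hBθ : 0 ≤ B₃ + θ' * (B₃ * (1 - θ * c)⁻¹) * c := add_nonneg hB₃ hθA₃
  have hK₂ : 0 ≤ B₃ * (B₃ * (B₀ * (1 - θ * c)⁻¹) * c) * c := mul_nonneg (mul_nonneg hB₃ hK₁) hc
  have hC : HasMaj (cNorm R₀ H₀ 𝔬.blk hG.lenle 0) (cNorm R₀ H₀ 𝔬.blkY hG.lenle 1)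
      ((𝔬.D U ∘ₗ 𝔬.G1 U ∘ₗ 𝔬.Qstar U) ∘ₗ (𝔬.C1 U ∘ₗ (𝔬.Q U ∘ₗ (𝔬.G1 U ∘ₗ LinearMap.id))))
      (fun y y' => (weightNorm (BlockNorm.ofBlocks (toB6 g R₀ H₀) 𝔬.blkZ) wZ fun y => (hwZ y).le).κ *
        (B₃ + θ' * (B₃ * (1 - θ * c)⁻¹) * c) *
        (B₃ * (B₃ * (B₀ * (1 - θ * c)⁻¹) * c) * c) * c * Real.exp (-(ρ' * g.dist y y'))) :=
    hasMaj_comp_exp htri hG.dnn hrow hBθ hK₂ hρ' (by linarith) le_rfl hD1Q hCQG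
  simp only [weightNorm_ofBlocks_κ, one_mul] at hC
  -- (e) assembling (3.153) differentiated on the left
  have h := ((hD1.of_rate_le hG.dnn hCL (by linarith : ρ' ≤ ρ)).sub hB).sub hC
  rw [← D_GG_eq hI] at h
  have hC0 : 0 ≤ constD313 (B₀ + θ' * (B₀ * (1 - θ * c)⁻¹) * c) θ' (B₀ * (1 - θ * c)⁻¹) (B₃ * (1 - θ * c)⁻¹) B₃ bH.κ c :=
    constD313_nonneg hCL hθ' hA₁ hA₃ hB₃ bH.κ_nonneg hc
  have h2 : HasMaj (cNorm R₀ H₀ 𝔬.blk hG.lenle 0) (cNorm R₀ H₀ 𝔬.blkY hG.lenle 1) (𝔬.D U ∘ₗ 𝔬.GG U)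
      (fun a b => constD313 (B₀ + θ' * (B₀ * (1 - θ * c)⁻¹) * c) θ' (B₀ * (1 - θ * c)⁻¹) (B₃ * (1 - θ * c)⁻¹) B₃ bH.κ c *
        Real.exp (-(ρ' * g.dist a b))) :=
    h.mono fun a b => le_of_eq (by simp only [constD313, toB6_dist]; ring)
  have h' := hasMajorantHom_of_hasMaj_cNorm hG (fun a b => mul_nonneg hC0 (Real.exp_nonneg _)) h2
  refine hasMajorantHom_mono (g := toB6 g R₀ H₀) 𝔬.blk 𝔬.blkY h' fun a b => le_of_eq ?_
  simp only [wt, pow_zero, pow_one, inv_one, mul_one]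
  ring

end OneMember

end

end Literature.MathematicalPhysics.QuantumFieldTheory.Balaban1983to89.B9Thm313WholeSupReadersCut
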